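import Mathlib.Analysis.SpecialFunctions.Pow.Deriv
import Mathlib.Analysis.SpecialFunctions.Pow.Asymptotics
import Mathlib.Analysis.SpecialFunctions.Complex.Arg
import Mathlib.Analysis.Calculus.Deriv.Polynomial
import Summits.Schanuel.Schanuel.Theorems.ZilberEacComplexMovingPolydiscLocal
import Summits.Schanuel.Schanuel.Theorems.ZilberEacComplexSecondOrder
import Summits.Schanuel.Schanuel.Theorems.ZilberEacComplexQuadricCoverLemmas
import HarnessLib

/-!
# EC over quadric covers `xₙ² = P(x')` with imaginary leading root (polynomial-decay regime)

For a double cover `xₙ² = P(x')` (`deg P = 2`) of `ℂˢ` the cyclic-cover theorem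
(`ZilberEacComplexCyclicCover.lean`) needs a lattice direction with `P₂(2πi q) ∉ (-∞, 0]`; it says
nothing when `P₂(2πi q)` is a negative real for every `q` — e.g. `P₂ = x₁² + ⋯ + xₛ²`
(`P₂(2πi q) = -4π²|q|²`), the "hyperboloids" `xₙ² = x₁² + ⋯ + xₛ² + c`. Then `√P` is imaginary
to leading order and `Re xₙ` neither tends to `-∞` like a power of `m` nor stays bounded: on the
unit polydisc around the lattice centre `x₀(m)` (where `Re xⱼ = dⱼ log m + O(1)` is forced by the
fibre `yⱼ = Aⱼ(x') + …`, `dⱼ = deg Aⱼ`),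

  `Re xₙ = ± (λ / 4β) · log m + O(1)`,  `λ = Σⱼ dⱼ Im (∂ⱼP₂)(2πi q)`, `P₂(2πi q) = -β²`,

(second-order expansion of `√(m² P₂(v)(1+u))`, `u = O(log m / m)`, via
`re_eval_le_of_secondOrder_sharp` applied to `∓i P`). So `yₙ = e^{xₙ}` tends to the puncture only
POLYNOMIALLY, `|yₙ| ≍ m^{-|λ|/4β}` on the right branch — enough for fibres whose dependence on
`yₙ` is through `yₙ` alone:

* `exists_expPoint_quadricCover` — **EC for `V = {xₙ² = P(x'), yⱼ = Aⱼ(x') + yₙ Fⱼ(yₙ)}`**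
  (`Fⱼ ∈ ℂ[u]`) when `deg P = 2`, `P₂(2πi q) ∈ ℝ_{<0}`, `(Aⱼ)_{dⱼ}(2πi q) ≠ 0` and `λ ≠ 0`
  (EC vocabulary and the model system `t² = z² + w² + 1, e^z = z + e^t, e^w = w - e^t` in
  `ZilberEacComplexQuadricCoverExamples.lean`; analytic lemmas in `…QuadricCoverLemmas.lean`).

Engine: the local moving-polydisc theorem `exists_exp_eq_poly_add_near_latticeCentre_local`.
First open rung of EAC (`dim π₁ V = n - 1`): Mantova–Masser, PLMS 129 (2024), §1 p. 5.
HONEST FRAMING: a modest new sub-rung of EAC; nothing here bears on Schanuel's conjecture.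
-/

noncomputable section

open Complex MvPolynomial Metric Set Filter Topology

set_option linter.dupNamespace false

namespace Summit.Schanuel.Schanuel.Theorems

/-! ### EC over quadric covers with imaginary leading root -/

/-- **EC over a quadric cover `xₙ² = P(x')` with imaginary leading root and fibres
`yⱼ = Aⱼ(x') + yₙ Fⱼ(yₙ)` (polynomial-decay regime).** Let `q ∈ ℤˢ`, `v = 2πi q`,
`P ∈ ℂ[x₁..xₛ]` of total degree `2` whose leading value `P₂(v)` is a NEGATIVE REAL number
(e.g. `P₂ = x₁² + ⋯ + xₛ²`, every `q ≠ 0`), `Aⱼ ∈ ℂ[x']` with `(Aⱼ)_{dⱼ}(v) ≠ 0`, `Fⱼ ∈ ℂ[u]`, and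
assume `λ := Σⱼ dⱼ · Im (∂ⱼ P₂)(v) ≠ 0`. Then for all large `m` there are `x' ∈ ℂˢ` within `1/2`
of the lattice centre `x₀(m)` and `xₙ` with `xₙ² = P(x')` and
`exp xⱼ = Aⱼ(x') + e^{xₙ} Fⱼ(e^{xₙ})` (`j ≤ s`): the `(s+1)`-fold
`V = {xₙ² = P(x'), yⱼ = Aⱼ(x') + yₙ Fⱼ(yₙ)} ⊆ ℂ^{s+1} × (ℂˣ)^{s+1}` — additive projection the quadric
`xₙ² = P(x')`, `dim π₁ V = n - 1`, first open range of Exponential-Algebraic Closedness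
(Mantova–Masser 2024 §1 p. 5) — meets the graph of `exp`. Mechanism: `xₙ = ±iβm(1+u)^{1/2}`
(`P₂(v) = -β²`, `u = (P(x') - m²P₂(v))/(m²P₂(v)) = O(log m/m)`), and
`Re xₙ = ±Im P(x')/(2mβ) + O(log²m/m)` where `±Im P = Re(∓iP)` falls under the sharp second-order
bound (`re_eval_le_of_secondOrder_sharp`, `κ = ∓λ`), so `|yₙ| ≤ e · m^{-|λ|/4β}`: a polynomial (not
super-polynomial) approach to the puncture, absorbed by the local moving-polydisc theorem because
the fibre depends on `yₙ` only through `yₙ Fⱼ(yₙ)`. New (complements the cyclic-cover theorem,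
which needs `P₂(v) ∉ (-∞,0]`). [cite: MantovaMasser2023, §1 p.5 (the open case dim π(V) = 2 in ℂ³×ℂˣ³)] -/
theorem exists_expPoint_quadricCover {s : ℕ} (P : MvPolynomial (Fin s) ℂ) (hP2 : P.totalDegree = 2)
    (q : Fin s → ℤ)
    (hbim : (eval (fun j => 2 * Real.pi * I * (q j : ℂ)) (homogeneousComponent 2 P)).im = 0)
    (hbre : (eval (fun j => 2 * Real.pi * I * (q j : ℂ)) (homogeneousComponent 2 P)).re < 0)
    (A : Fin s → MvPolynomial (Fin s) ℂ)
    (hA : ∀ j, eval (fun i => 2 * Real.pi * I * (q i : ℂ))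
      (homogeneousComponent (A j).totalDegree (A j)) ≠ 0)
    (hlam : ∑ j, ((A j).totalDegree : ℝ) * (eval (fun i => 2 * Real.pi * I * (q i : ℂ))
      (pderiv j (homogeneousComponent 2 P))).im ≠ 0)
    (F : Fin s → Polynomial ℂ) :
    ∀ᶠ m : ℕ in atTop, ∃ x : Fin s → ℂ, ∃ xn : ℂ,
      ‖x - fun i => (m : ℂ) * (2 * Real.pi * I * (q i : ℂ)) +
          log (eval (fun k => (m : ℂ) * (2 * Real.pi * I * (q k : ℂ))) (A i))‖ ≤ 1 / 2 ∧
      xn ^ 2 = eval x P ∧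
      ∀ j, exp (x j) = eval x (A j) + exp xn * (F j).eval (exp xn) := by
  classical
  set v : Fin s → ℂ := fun j => 2 * Real.pi * I * (q j : ℂ) with hv
  set P2 := homogeneousComponent 2 P with hP2def
  set b : ℂ := eval v P2 with hbdef
  -- `b = -β²`
  set β : ℝ := Real.sqrt (-b.re) with hβdef
  have hβ : 0 < β := Real.sqrt_pos.mpr (by linarith)
  have hβ2 : β ^ 2 = -b.re := Real.sq_sqrt (by linarith)
  have hb : b = -((β : ℂ) ^ 2) := by
    apply Complex.ext
    · simp only [Complex.neg_re]
      rw [show ((β : ℂ) ^ 2) = ((β ^ 2 : ℝ) : ℂ) by push_cast; rfl, Complex.ofReal_re, hβ2]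
      ring
    · simp only [Complex.neg_im]
      rw [show ((β : ℂ) ^ 2) = ((β ^ 2 : ℝ) : ℂ) by push_cast; rfl, Complex.ofReal_im, hbim]
      simp
  have hb0 : b ≠ 0 := by rw [hb]; exact neg_ne_zero.mpr (pow_ne_zero _ (by exact_mod_cast hβ.ne'))
  -- the sign `σ` with `σ λ < 0`
  set lam : ℝ := ∑ j, ((A j).totalDegree : ℝ) * (eval v (pderiv j P2)).im with hlamdef
  set σ : ℝ := if lam < 0 then 1 else -1 with hσdef
  have hσ : σ = 1 ∨ σ = -1 := by
    by_cases h : lam < 0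
    · exact Or.inl (by simp [hσdef, h])
    · exact Or.inr (by simp [hσdef, h])
  have hσlam : σ * lam < 0 := by
    by_cases h : lam < 0
    · have hσ1 : σ = 1 := by simp [hσdef, h]
      rw [hσ1, one_mul]; exact h
    · have hσ1 : σ = -1 := by simp [hσdef, h]
      rw [hσ1, neg_one_mul, neg_lt_zero]
      exact lt_of_le_of_ne (not_lt.mp h) (Ne.symm hlam)
  -- the rotated polynomial `g = -σ i P`
  set c : ℂ := -(σ : ℂ) * I with hcdef
  have hcre : c.re = 0 := by simp [hcdef]
  have hcim : c.im = -σ := by simp [hcdef]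
  have hc0 : c ≠ 0 := by
    intro h0
    have := congrArg Complex.im h0
    rw [hcim, Complex.zero_im] at this
    rcases hσ with h | h <;> simp [h] at this
  set g : MvPolynomial (Fin s) ℂ := C c * P with hgdef
  have hgdeg : g.totalDegree = 2 := by
    refine le_antisymm ((totalDegree_mul _ _).trans (by rw [totalDegree_C, zero_add, hP2])) ?_
    have h1 : P = C c⁻¹ * g := by
      rw [hgdef, ← mul_assoc, ← C_mul, inv_mul_cancel₀ hc0, C_1, one_mul]
    calc 2 = P.totalDegree := hP2.symm
      _ ≤ (C c⁻¹ * g).totalDegree := by rw [← h1]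
      _ ≤ g.totalDegree := (totalDegree_mul _ _).trans (by rw [totalDegree_C, zero_add])
  have hgtop : homogeneousComponent g.totalDegree g = C c * P2 := by
    rw [hgdeg, hgdef, homogeneousComponent_C_mul]
  have hre_g : (eval v (homogeneousComponent g.totalDegree g)).re = 0 := by
    rw [hgtop, map_mul, eval_C, Complex.mul_re, hcre, hcim, zero_mul, hbim, mul_zero, sub_zero]
  have heval_g : ∀ x, (eval x g).re = σ * (eval x P).im := by
    intro x
    rw [hgdef, map_mul, eval_C, Complex.mul_re, hcre, hcim]; ring
  have hκeq : ∑ j, ((A j).totalDegree : ℝ) *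
      (eval v (pderiv j (homogeneousComponent g.totalDegree g))).re = σ * lam := by
    rw [hgtop, hlamdef, Finset.mul_sum]
    refine Finset.sum_congr rfl fun j _ => ?_
    rw [pderiv_C_mul, map_mul, eval_C, Complex.mul_re, hcre, hcim]; ring
  have hκ : ∑ j, ((A j).totalDegree : ℝ) *
      (eval v (pderiv j (homogeneousComponent g.totalDegree g))).re < 0 := by
    rw [hκeq]; exact hσlam
  -- constants of the lattice values and the box
  set a : Fin s → ℝ := fun j => ‖eval v (homogeneousComponent (A j).totalDegree (A j))‖ with ha
  set C₀ : ℝ := 1 + Real.pi + ∑ j, (|Real.log (a j / 2)| + |Real.log (2 * a j)|) with hC₀def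
  have hsum0 : 0 ≤ ∑ j, (|Real.log (a j / 2)| + |Real.log (2 * a j)|) :=
    Finset.sum_nonneg fun j _ => by positivity
  have hC₀ : 0 ≤ C₀ := by have := Real.pi_pos; rw [hC₀def]; positivity
  have hCj : ∀ j, |Real.log (a j / 2)| + |Real.log (2 * a j)| ≤
      ∑ i, (|Real.log (a i / 2)| + |Real.log (2 * a i)|) := fun j =>
    Finset.single_le_sum (f := fun i => |Real.log (a i / 2)| + |Real.log (2 * a i)|)
      (fun i _ => by positivity) (Finset.mem_univ j)
  set Sd : ℝ := ∑ j, ((A j).totalDegree : ℝ) with hSd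
  have hSd0 : 0 ≤ Sd := Finset.sum_nonneg fun j _ => Nat.cast_nonneg _
  -- the sharp second-order bound for `g`
  have hsharp := re_eval_le_of_secondOrder_sharp g v (by rw [hgdeg]) hre_g
    (fun j => (A j).totalDegree) hC₀ hκ
  rw [hκeq, hgdeg] at hsharp
  -- size of `P(x) - m² b` on the box
  obtain ⟨K₁, hK₁, K₂, hK₂, hdiff⟩ := quadric_eval_sub_bound P hP2 v hSd0 (by positivity : (0:ℝ) ≤ 2 * C₀)
  -- decay rate
  set γ : ℝ := -(σ * lam) / (4 * β) with hγdef
  have hγ : 0 < γ := by rw [hγdef]; exact div_pos (by linarith) (by positivity)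
  -- bound for the fibre polynomials on `‖y‖ ≤ e`
  have hFb : ∀ j, ∃ M : ℝ, 0 ≤ M ∧ ∀ y : ℂ, ‖y‖ ≤ Real.exp 1 → ‖(F j).eval y‖ ≤ M := by
    intro j
    obtain ⟨M, hM⟩ := (isCompact_closedBall (0 : ℂ) (Real.exp 1)).exists_bound_of_continuousOn
      ((F j).continuous).continuousOn
    refine ⟨max M 0, le_max_right _ _, fun y hy => (hM y ?_).trans (le_max_left _ _)⟩
    rwa [mem_closedBall, dist_zero_right]
  choose M hM0 hMb using hFb
  -- ### the branch and the perturbation, as functions of `m` and `x`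
  set u : ℕ → (Fin s → ℂ) → ℂ := fun m x => (eval x P - (m : ℂ) ^ 2 * b) / ((m : ℂ) ^ 2 * b) with hudef
  set xn : ℕ → (Fin s → ℂ) → ℂ := fun m x =>
    (σ : ℂ) * I * β * ((m : ℝ) : ℂ) * (1 + u m x) ^ ((2 : ℂ)⁻¹) with hxndef
  set Pm : ℕ → Fin s → (Fin s → ℂ) → ℂ := fun m j x => exp (xn m x) * (F j).eval (exp (xn m x))
    with hPmdef
  set x₀ : ℕ → Fin s → ℂ := fun m i => (m : ℂ) * v i + log (eval (fun k => (m : ℂ) * v k) (A i))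
    with hx₀
  -- ### the key eventual estimate on the unit polydiscs: `|u| ≤ 1/2` and `Re xn ≤ -γ log m + 1`
  have hkey : ∀ᶠ m : ℕ in atTop, ∀ ξ : Fin s → ℂ, ‖ξ‖ < 1 →
      ‖u m (x₀ m + ξ)‖ ≤ 1 / 2 ∧ (xn m (x₀ m + ξ)).re ≤ -(γ * Real.log m) + 1 := by
    filter_upwards [hsharp, hdiff, eventually_all.2 fun j => latticeValue_eventually (A j) v (hA j),
      eventually_mul_log_add_le K₁ K₂ (by positivity : 0 < β ^ 2 / 2),
      eventually_sq_mul_log_add_le K₁ K₂ (by positivity : 0 < 2 * β ^ 3), eventually_ge_atTop 1]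
      with m hms hmd hlv hm1 hm2 hm_one
    intro ξ hξ
    have hm1' : (1 : ℝ) ≤ m := by exact_mod_cast hm_one
    have hm0 : (0 : ℝ) < m := by linarith
    have hlog0 : 0 ≤ Real.log m := Real.log_nonneg hm1'
    -- the box
    set η : Fin s → ℂ := (fun i => log (eval (fun k => (m : ℂ) * v k) (A i))) + ξ with hη
    have hsplit : x₀ m + ξ = (fun i => (m : ℂ) * v i) + η := by
      funext i; simp only [hx₀, hη, Pi.add_apply]; ring
    have hξj : ∀ j, ‖ξ j‖ ≤ 1 := fun j => (norm_le_pi_norm ξ j).trans hξ.le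
    have hbox_re : ∀ j, |(η j).re - (A j).totalDegree * Real.log m| ≤ C₀ := by
      intro j
      obtain ⟨-, ⟨h1, h2⟩, -⟩ := hlv j
      have hre' : (η j).re = Real.log ‖eval (fun k => (m : ℂ) * v k) (A j)‖ + (ξ j).re := by
        simp only [hη, Pi.add_apply, Complex.add_re, Complex.log_re]
      have h3 : |(ξ j).re| ≤ 1 := (Complex.abs_re_le_norm _).trans (hξj j)
      rw [hre', abs_le]
      rw [abs_le] at h3
      have h4 : -|Real.log (a j / 2)| ≤ Real.log (a j / 2) := neg_abs_le _
      have h5 : Real.log (2 * a j) ≤ |Real.log (2 * a j)| := le_abs_self _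
      have h6 := hCj j
      have h7 : a j = ‖eval v (homogeneousComponent (A j).totalDegree (A j))‖ := rfl
      rw [← h7] at h1 h2
      have hpi := Real.pi_pos
      have h8 : 0 ≤ |Real.log (2 * a j)| := abs_nonneg _
      have h9 : 0 ≤ |Real.log (a j / 2)| := abs_nonneg _
      obtain ⟨h3a, h3b⟩ := h3
      constructor <;> linarith
    have hbox_im : ∀ j, |(η j).im| ≤ C₀ := by
      intro j
      have him' : (η j).im = arg (eval (fun k => (m : ℂ) * v k) (A j)) + (ξ j).im := by
        simp only [hη, Pi.add_apply, Complex.add_im, Complex.log_im]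
      have h3 : |(ξ j).im| ≤ 1 := (Complex.abs_im_le_norm _).trans (hξj j)
      have h4 : |arg (eval (fun k => (m : ℂ) * v k) (A j))| ≤ Real.pi := Complex.abs_arg_le_pi _
      rw [him']
      refine (abs_add_le _ _).trans ?_
      rw [hC₀def]; linarith
    have hηn : ‖η‖ ≤ Sd * Real.log m + 2 * C₀ :=
      norm_le_of_box η (fun j => (A j).totalDegree) hC₀ hlog0 hbox_re hbox_im
    -- `|P(x) - m² b| ≤ m (K₁ log m + K₂)` and `|u| ≤ 1/2`
    have hPd := hmd η hηn
    rw [← hsplit] at hPd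
    have hm2b : ‖(m : ℂ) ^ 2 * b‖ = (m : ℝ) ^ 2 * β ^ 2 := by
      rw [norm_mul, norm_pow, Complex.norm_natCast, hb, norm_neg, norm_pow, Complex.norm_real,
        Real.norm_of_nonneg hβ.le]
    have hm2b0 : (m : ℂ) ^ 2 * b ≠ 0 := mul_ne_zero (pow_ne_zero _ (by exact_mod_cast hm0.ne')) hb0
    have hun : ‖u m (x₀ m + ξ)‖ ≤ (K₁ * Real.log m + K₂) / (m * β ^ 2) := by
      show ‖(eval (x₀ m + ξ) P - (m : ℂ) ^ 2 * b) / ((m : ℂ) ^ 2 * b)‖ ≤ _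
      rw [norm_div, hm2b, div_le_iff₀ (by positivity)]
      calc ‖eval (x₀ m + ξ) P - (m : ℂ) ^ 2 * b‖ ≤ m * (K₁ * Real.log m + K₂) := hPd
        _ = (K₁ * Real.log m + K₂) / (m * β ^ 2) * ((m : ℝ) ^ 2 * β ^ 2) := by
            field_simp
    have hu12 : ‖u m (x₀ m + ξ)‖ ≤ 1 / 2 := by
      refine hun.trans ?_
      rw [div_le_iff₀ (by positivity)]
      linarith
    refine ⟨hu12, ?_⟩
    -- the real part of the branch
    obtain ⟨-, hrele, -⟩ := quadricBranch_re_le hu12 hβ.le hm0.le hσ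
    have huim : (u m (x₀ m + ξ)).im = -(eval (x₀ m + ξ) P).im / ((m : ℝ) ^ 2 * β ^ 2) := by
      show ((eval (x₀ m + ξ) P - (m : ℂ) ^ 2 * b) / ((m : ℂ) ^ 2 * b)).im = _
      have h1 : (m : ℂ) ^ 2 * b = ((-((m : ℝ) ^ 2 * β ^ 2) : ℝ) : ℂ) := by
        rw [hb]; push_cast; ring
      rw [h1, Complex.div_ofReal_im, Complex.sub_im, Complex.ofReal_im, sub_zero, div_neg, neg_div]
    have hmain : -σ * β * m * (u m (x₀ m + ξ)).im / 2 = (eval (x₀ m + ξ) g).re / (2 * m * β) := by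
      rw [huim, heval_g]
      field_simp
      try ring
    have hgle : (eval (x₀ m + ξ) g).re ≤ σ * lam / 2 * (m : ℝ) ^ (2 - 1) * Real.log m := by
      rw [hsplit]; exact hms η hbox_re hbox_im
    rw [show (2 - 1 : ℕ) = 1 from rfl, pow_one] at hgle
    have h1 : (eval (x₀ m + ξ) g).re / (2 * m * β) ≤ -(γ * Real.log m) := by
      rw [div_le_iff₀ (by positivity), hγdef]
      have : -(-(σ * lam) / (4 * β) * Real.log m) * (2 * m * β) =
          σ * lam / 2 * m * Real.log m := by field_simp; ring
      rw [this]; exact hgle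
    have h2 : β * m * (‖u m (x₀ m + ξ)‖ ^ 2 / 2) ≤ 1 := by
      have h3 : ‖u m (x₀ m + ξ)‖ ^ 2 ≤ ((K₁ * Real.log m + K₂) / (m * β ^ 2)) ^ 2 :=
        pow_le_pow_left₀ (norm_nonneg _) hun 2
      have h4 : β * m * (((K₁ * Real.log m + K₂) / (m * β ^ 2)) ^ 2 / 2) =
          (K₁ * Real.log m + K₂) ^ 2 / (2 * β ^ 3 * m) := by
        field_simp
        try ring
      calc β * m * (‖u m (x₀ m + ξ)‖ ^ 2 / 2)
          ≤ β * m * (((K₁ * Real.log m + K₂) / (m * β ^ 2)) ^ 2 / 2) := by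
            gcongr
        _ = (K₁ * Real.log m + K₂) ^ 2 / (2 * β ^ 3 * m) := h4
        _ ≤ 1 := by rw [div_le_one (by positivity)]; exact hm2
    show ((σ : ℂ) * I * β * ((m : ℝ) : ℂ) * (1 + u m (x₀ m + ξ)) ^ ((2 : ℂ)⁻¹)).re ≤
      -(γ * Real.log m) + 1
    linarith [hrele, hmain.symm.le, hmain.le]
  -- ### holomorphy of the perturbation on the unit polydiscs
  have hPdiff : ∀ᶠ m : ℕ in atTop, ∀ j, DifferentiableOn ℂ (Pm m j) (ball (x₀ m) 1) := by
    filter_upwards [hkey, eventually_ge_atTop 1] with m hm hm_one j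
    have hm0 : (0 : ℝ) < m := by exact_mod_cast hm_one
    have hm2b0 : (m : ℂ) ^ 2 * b ≠ 0 := mul_ne_zero (pow_ne_zero _ (by exact_mod_cast hm0.ne')) hb0
    have hu_diff : DifferentiableOn ℂ (u m) (ball (x₀ m) 1) := by
      have h1 : Differentiable ℂ (fun x : Fin s → ℂ =>
          (eval x P - (m : ℂ) ^ 2 * b) * ((m : ℂ) ^ 2 * b)⁻¹) :=
        ((differentiable_mvPolynomial_eval P).sub_const _).mul_const _
      have h2 : u m = fun x => (eval x P - (m : ℂ) ^ 2 * b) * ((m : ℂ) ^ 2 * b)⁻¹ := by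
        funext x; simp only [hudef, div_eq_mul_inv]
      rw [h2]; exact h1.differentiableOn
    have hmaps : MapsTo (fun x => 1 + u m x) (ball (x₀ m) 1) slitPlane := by
      intro x hx
      rw [mem_ball, dist_eq_norm] at hx
      have h := (hm (x - x₀ m) hx).1
      rw [add_sub_cancel] at h
      refine Complex.ball_one_subset_slitPlane ?_
      rw [mem_ball, dist_eq_norm, add_sub_cancel_left]
      linarith
    have hxn_diff : DifferentiableOn ℂ (xn m) (ball (x₀ m) 1) := by
      have h1 : DifferentiableOn ℂ (fun x => (1 + u m x) ^ ((2 : ℂ)⁻¹)) (ball (x₀ m) 1) :=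
        ((differentiableOn_const _).add hu_diff).cpow (differentiableOn_const _) hmaps
      show DifferentiableOn ℂ (fun x => (σ : ℂ) * I * β * ((m : ℝ) : ℂ) * (1 + u m x) ^ ((2 : ℂ)⁻¹)) _
      exact h1.const_mul _
    have hexp_diff : DifferentiableOn ℂ (fun x => exp (xn m x)) (ball (x₀ m) 1) := hxn_diff.cexp
    exact hexp_diff.mul ((F j).differentiable.comp_differentiableOn hexp_diff)
  -- ### smallness of the perturbation
  have hPsmall : ∀ j, ∀ θ : ℝ, 0 < θ → ∀ᶠ m : ℕ in atTop, ∀ ξ : Fin s → ℂ, ‖ξ‖ < 1 →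
      ‖Pm m j (x₀ m + ξ)‖ ≤ θ * (m : ℝ) ^ (A j).totalDegree := by
    intro j θ hθ
    have hdec : Tendsto (fun m : ℕ => Real.exp 1 * M j * (m : ℝ) ^ (-γ)) atTop (𝓝 0) := by
      have h := ((tendsto_rpow_neg_atTop hγ).comp tendsto_natCast_atTop_atTop).const_mul
        (Real.exp 1 * M j)
      rw [mul_zero] at h
      exact h
    filter_upwards [hkey, hdec.eventually (eventually_le_nhds hθ), eventually_ge_atTop 1]
      with m hm hmθ hm_one ξ hξ
    have hm1' : (1 : ℝ) ≤ m := by exact_mod_cast hm_one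
    have hm0 : (0 : ℝ) < m := by linarith
    obtain ⟨-, hre⟩ := hm ξ hξ
    have hexp : ‖exp (xn m (x₀ m + ξ))‖ ≤ Real.exp 1 * (m : ℝ) ^ (-γ) := by
      rw [Complex.norm_exp]
      refine (Real.exp_le_exp.mpr hre).trans ?_
      rw [show -(γ * Real.log m) + 1 = 1 + -(γ * Real.log m) by ring, Real.exp_add,
        Real.rpow_def_of_pos hm0]
      ring_nf
      rfl
    have hexp1 : ‖exp (xn m (x₀ m + ξ))‖ ≤ Real.exp 1 := by
      refine hexp.trans ?_
      have : (m : ℝ) ^ (-γ) ≤ 1 := by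
        rw [Real.rpow_neg hm0.le]
        exact inv_le_one_of_one_le₀ (Real.one_le_rpow hm1' hγ.le)
      nlinarith [Real.exp_pos 1]
    have hF := hMb j _ hexp1
    calc ‖Pm m j (x₀ m + ξ)‖
        = ‖exp (xn m (x₀ m + ξ))‖ * ‖(F j).eval (exp (xn m (x₀ m + ξ)))‖ := norm_mul _ _
      _ ≤ Real.exp 1 * (m : ℝ) ^ (-γ) * M j := mul_le_mul hexp hF (norm_nonneg _) (by positivity)
      _ = Real.exp 1 * M j * (m : ℝ) ^ (-γ) := by ring
      _ ≤ θ := hmθ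
      _ ≤ θ * (m : ℝ) ^ (A j).totalDegree := le_mul_of_one_le_right hθ.le (one_le_pow₀ hm1')
  -- ### the local moving-polydisc theorem
  have hmain := exists_exp_eq_poly_add_near_latticeCentre_local q A hA Pm hPdiff hPsmall
  filter_upwards [hmain, eventually_ge_atTop 1] with m hm hm_one
  obtain ⟨x, hxd, hx⟩ := hm
  have hm0 : (0 : ℝ) < m := by exact_mod_cast hm_one
  have hm2b0 : (m : ℂ) ^ 2 * b ≠ 0 := mul_ne_zero (pow_ne_zero _ (by exact_mod_cast hm0.ne')) hb0
  refine ⟨x, xn m x, hxd, ?_, hx⟩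
  -- `xn² = P(x)`
  have hsq : ((1 + u m x) ^ ((2 : ℂ)⁻¹)) ^ 2 = 1 + u m x := by
    have h := Complex.cpow_nat_inv_pow (1 + u m x) (n := 2) two_ne_zero
    simp only [Nat.cast_ofNat] at h
    exact h
  show ((σ : ℂ) * I * β * ((m : ℝ) : ℂ) * (1 + u m x) ^ ((2 : ℂ)⁻¹)) ^ 2 = eval x P
  have hσ2 : (σ : ℂ) ^ 2 = 1 := by rcases hσ with h | h <;> simp [h]
  calc ((σ : ℂ) * I * β * ((m : ℝ) : ℂ) * (1 + u m x) ^ ((2 : ℂ)⁻¹)) ^ 2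
      = (σ : ℂ) ^ 2 * I ^ 2 * (β : ℂ) ^ 2 * (m : ℂ) ^ 2 * ((1 + u m x) ^ ((2 : ℂ)⁻¹)) ^ 2 := by
        rw [Complex.ofReal_natCast]; ring
    _ = (m : ℂ) ^ 2 * b * (1 + u m x) := by rw [hσ2, Complex.I_sq, hsq, hb]; ring
    _ = eval x P := by
        show (m : ℂ) ^ 2 * b * (1 + (eval x P - (m : ℂ) ^ 2 * b) / ((m : ℂ) ^ 2 * b)) = eval x P
        rw [mul_add, mul_one, mul_div_cancel₀ _ hm2b0]
        ring


end Summit.Schanuel.Schanuel.Theorems
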